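import Summits.ResolutionOfSingularities.ResolutionOfSingularities.Theorems.PurelyInseparableDim4E2OfCJSRows
import Summits.ResolutionOfSingularities.ResolutionOfSingularities.Theorems.PurelyInseparableDim4PointStepChart
import Summits.ResolutionOfSingularities.ResolutionOfSingularities.Theorems.PurelyInseparableDim4PointLastStep
import Mathlib.Topology.JacobsonSpace
import HarnessLib

/-!
# F4-I(3,3) from CJS — row (M) split, part (M-a): the GLOBAL MODEL of a frame chain — an infinite tower of
# point blow-ups of ambients with marked ideals `(z³ + F_i)·𝒪` read on open-immersion charts
# (cell `res-dim4-pi`, WORD #52 (c) / #57; sub-row (M) of the E2 transfer row)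

[OURS · counted 0 · AI work weaker than expert review.]  Cell `res-dim4-pi` (D-0157 DOOR 2), seat `res-dim4-p-2`
g2; K → res-dim4-p-9 g2.  NOTHING here proves `ModelRow`, `NoIsolatedTrap 3 3` or resolution of singularities in
dimension ≥ 4 / characteristic `p`.

Row (M) `E2OfCJS.ModelRow` (p663940) asks, for an E2-violating frame chain over an algebraically closed `K`,
for the chain of LOCAL hypersurface schemes, point blow-ups, closed near points and local-scheme links, every
node presented by the frame's polynomial.  It splits as (M-a) GLOBAL MODEL ∘ (M-b) LOCALISATION.  THIS FILE
is (M-a), PROVED, with typ-3's point-centre chart engine (`Equimultiple.exists_chart_step'`, p656862 — the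
«chart of a chart»: from an open-immersion chart `φ : 𝔸⁵ ⟶ Z` at `x₀` on which the marked ideal reads
`(z³ + F)·𝒪`, for ANY blowing up of `x₀` and EVERY `(j, b)` there is a chart `φ′ : 𝔸⁵ ⟶ W` at a point over
`x₀` on which the transformed marked ideal reads `(z³ + (step 3 univ j b s).F)·𝒪`) iterated along the chain
over the tree's chosen blow-ups `blowup`:

* §1 `GStage K F` — a STAGE: ambient `Z` (locally noetherian, Jacobson), marked ideal `M` of multiplicity
  `3`, a CLOSED point `x`, an open-immersion chart `φ : 𝔸⁵_K ⟶ Z` with `φ 0 = x` and `M.ideal.comap φ =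
  hypSheaf 3 F`; `GStage.init` (𝔸⁵ itself) and `GStage.next` (blow up `x`, transform `M`, re-chart by
  `exists_chart_step'`; the new point is CLOSED because blow-ups of Jacobson schemes are Jacobson and an open
  immersion pulls closed points back to closed points);
* §2 `GStage.tower` — the recursion along a `Step0 3` chain `c`, stage `i` carrying `(c i).F`;
* §3 **`globalModel`** — for every field `K` of characteristic `3` with `PerfectRing K 3` (e.g. `K`
  algebraically closed) and every chain `c` with `Step0 3 (c k) (c (k+1))` for all `k`: ambients `Z i`, marked
  ideals `M i` (`mult = 3`), closed points `x i`, charts `φ i`, and blow-ups `π i : Z (i+1) ⟶ Z i` of `x i` with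
  `M (i+1) = (M i).transform (π i) 𝓘_{x i}`, `π i (x (i+1)) = x i`, `(M i).ideal.comap (φ i) = hypSheaf 3 (c i).F`.

What (M) still needs after this file — (M-b) LOCALISATION (OURS, open; W4.2's base-change tools
`IsBlowup.pullback_snd_of_flat` / `isIso_stalkMap_pullback_fst_fromSpecStalk` / `exists_localTower_isLocalAt`,
plus (M-c) «the subscheme cut by the controlled (= strict) transform of `(z³ + F)·𝒪` IS the blow-up of the
hypersurface at the point» and the chart-to-stalk presentation `𝒪_{X_i,x_i} ≅ HypStalk K (c i).F`) — is NOT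
here.  bears_on: LADDER-RESOLUTION:D157-DOOR2 (res-dim4-pi · F4-I(3,3) · CJS dictionary · row M-a).  Supports
stmt-ResolutionOfSingularities-16155 (helper).
-/

set_option linter.dupNamespace false -- mandated namespace of this single-conjunct summit

noncomputable section

open CategoryTheory AlgebraicGeometry TopologicalSpace
open Literature.AlgebraicGeometry.Resolution
open Literature.AlgebraicGeometry.Resolution.Hauser2010
open Literature.AlgebraicGeometry.Resolution.AffinePointBlowup (P A ξ)
open Scheme.IdealSheafData

namespace Summit.ResolutionOfSingularities.ResolutionOfSingularities.Theorems.PIDim4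

namespace E2OfCJS

/-! ## §1 Stages of the global model -/

/-- [OURS] **A STAGE of the global model** over `K`, carrying the residual polynomial `F`: an ambient `Z`
(locally noetherian, Jacobson), a marked ideal `M` of multiplicity `3`, a CLOSED point `x`, and an
open-immersion chart `φ : 𝔸⁵_K ⟶ Z` at `x` on which `M` reads `(z³ + F)·𝒪` (typ-3's INVARIANT of
`…PointStepPackage`). [folklore] -/
structure GStage (K : Type) [Field K] (F : MvPolynomial (Fin 4) K) : Type 1 where
  /-- the ambient -/
  Z : Scheme.{0}
  /-- the ambient is locally noetherian -/
  ln : IsLocallyNoetherian Z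
  /-- the ambient is Jacobson (closed points of open charts are closed) -/
  js : JacobsonSpace Z
  /-- the marked ideal -/
  M : MarkedIdeal Z
  /-- of multiplicity `3` -/
  hmult : M.mult = 3
  /-- the marked point -/
  x : Z
  /-- it is closed -/
  hx : IsClosed ({x} : Set Z)
  /-- the chart -/
  φ : P 4 K ⟶ Z
  /-- the chart is an open immersion -/
  oi : IsOpenImmersion φ
  /-- the chart is centred at `x` -/
  hφ : φ (ξ 4 K) = x
  /-- on the chart the marked ideal is `(z³ + F)·𝒪` -/
  hM : M.ideal.comap φ = hypSheaf 3 F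

namespace GStage

variable {K : Type} [Field K]

/-- **The initial stage**: `𝔸⁵_K` itself, `M = ((z³ + F)·𝒪, ∅, 3)`, the origin, the identity chart. [folklore] -/
def init (F : MvPolynomial (Fin 4) K) : GStage K F where
  Z := P 4 K
  ln := inferInstance
  js := inferInstance
  M := ⟨hypSheaf 3 F, [], 3⟩
  hmult := rfl
  x := ξ 4 K
  hx := AffinePointBlowup.isClosed_ξ 4 K
  φ := 𝟙 (P 4 K)
  oi := inferInstance
  hφ := rfl
  hM := Scheme.IdealSheafData.comap_id _

/-- The point centre of a stage: the reduced closed point `x`. [folklore] -/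
def centre {F : MvPolynomial (Fin 4) K} (G : GStage K F) : G.Z.IdealSheafData :=
  vanishingIdeal ⟨{G.x}, G.hx⟩

variable [CharP K 3] [PerfectRing K 3] [DecidableEq K]

/-- The chart datum of the next stage (typ-3's `exists_chart_step'` over the chosen blow-up of `x`).
[cite: BierstoneGrigorievMilmanWlodarczyk2011, §3.2 and Lemma 8.0.3 (2)] -/
theorem exists_next_chart {F : MvPolynomial (Fin 4) K} (G : GStage K F) (s : State K) (hs : s.F = F)
    (hperm : ((3 : ℕ) : ℕ∞) ≤ CentreBlowup.ordAlong (Finset.univ : Finset (Fin 4)) s.F) (j : Fin 4)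
    {b : Fin 4 → K} (hbj : b j = 0) :
    ∃ (φ' : P 4 K ⟶ blowup G.centre) (_ : IsOpenImmersion φ'),
      blowup.π G.centre (φ' (ξ 4 K)) = G.x ∧
        (G.M.transform (blowup.π G.centre) G.centre).ideal.comap φ' =
          hypSheaf 3 (CentreBlowup.step 3 Finset.univ j b s).F := by
  haveI := G.ln
  haveI := G.oi
  haveI : Fact (Nat.Prime 3) := ⟨Nat.prime_three⟩
  exact Equimultiple.exists_chart_step' G.φ G.hx G.hφ G.M G.hmult s (hs ▸ G.hM) hperm
    (blowup.isBlowup G.centre) j hbj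

/-- **The next stage**: blow up the closed point `x`, transform the marked ideal, re-chart at the point of the
edge `(j, b)`; the new marked point is closed (Jacobson). [folklore] -/
def next {F : MvPolynomial (Fin 4) K} (G : GStage K F) (s : State K) (hs : s.F = F)
    (hperm : ((3 : ℕ) : ℕ∞) ≤ CentreBlowup.ordAlong (Finset.univ : Finset (Fin 4)) s.F) (j : Fin 4)
    {b : Fin 4 → K} (hbj : b j = 0) (F' : MvPolynomial (Fin 4) K)
    (hF' : (CentreBlowup.step 3 Finset.univ j b s).F = F') : GStage K F' := by
  haveI := G.ln
  haveI := G.js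
  let h := G.exists_next_chart s hs hperm j hbj
  let φ' := h.choose
  haveI hoi : IsOpenImmersion φ' := h.choose_spec.choose
  have hφ' := h.choose_spec.choose_spec
  have hπ := blowup.isBlowup G.centre
  haveI : IsLocallyNoetherian (blowup G.centre) := by
    haveI := hπ.isProper
    exact LocallyOfFiniteType.isLocallyNoetherian (blowup.π G.centre)
  haveI hjs : JacobsonSpace ↥(blowup G.centre) := Equimultiple.jacobsonSpace_of_isBlowup' hπ
  exact
    { Z := blowup G.centre
      ln := inferInstance
      js := hjs
      M := G.M.transform (blowup.π G.centre) G.centre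
      hmult := by rw [MarkedIdeal.transform_mult]; exact G.hmult
      x := φ' (ξ 4 K)
      hx := by
        -- `ξ` is closed in `𝔸⁵`; an open immersion into a Jacobson space pulls closed points back to closed points
        have hmem : ξ 4 K ∈ (φ' : P 4 K → blowup G.centre) ⁻¹' closedPoints (blowup G.centre) := by
          rw [φ'.isOpenEmbedding.preimage_closedPoints]
          exact AffinePointBlowup.isClosed_ξ 4 K
        exact hmem
      φ := φ'
      oi := hoi
      hφ := rfl
      hM := by rw [← hF']; exact hφ'.2 }

/-- The next stage's ambient IS the chosen blow-up of `x`. [folklore] -/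
theorem next_Z {F : MvPolynomial (Fin 4) K} (G : GStage K F) (s : State K) (hs : s.F = F)
    (hperm : ((3 : ℕ) : ℕ∞) ≤ CentreBlowup.ordAlong (Finset.univ : Finset (Fin 4)) s.F) (j : Fin 4)
    {b : Fin 4 → K} (hbj : b j = 0) (F' : MvPolynomial (Fin 4) K)
    (hF' : (CentreBlowup.step 3 Finset.univ j b s).F = F') :
    (G.next s hs hperm j hbj F' hF').Z = blowup G.centre := rfl

/-- `π_G : Bl_x(Z) ⟶ Z` maps the next marked point to `x`. [folklore] -/
theorem next_π_x {F : MvPolynomial (Fin 4) K} (G : GStage K F) (s : State K) (hs : s.F = F)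
    (hperm : ((3 : ℕ) : ℕ∞) ≤ CentreBlowup.ordAlong (Finset.univ : Finset (Fin 4)) s.F) (j : Fin 4)
    {b : Fin 4 → K} (hbj : b j = 0) (F' : MvPolynomial (Fin 4) K)
    (hF' : (CentreBlowup.step 3 Finset.univ j b s).F = F') :
    blowup.π G.centre ((G.next s hs hperm j hbj F' hF').x) = G.x :=
  (G.exists_next_chart s hs hperm j hbj).choose_spec.choose_spec.1

/-- The next marked ideal IS the transform of `M` under the blow-up of `x`. [folklore] -/
theorem next_M {F : MvPolynomial (Fin 4) K} (G : GStage K F) (s : State K) (hs : s.F = F)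
    (hperm : ((3 : ℕ) : ℕ∞) ≤ CentreBlowup.ordAlong (Finset.univ : Finset (Fin 4)) s.F) (j : Fin 4)
    {b : Fin 4 → K} (hbj : b j = 0) (F' : MvPolynomial (Fin 4) K)
    (hF' : (CentreBlowup.step 3 Finset.univ j b s).F = F') :
    (G.next s hs hperm j hbj F' hF').M = G.M.transform (blowup.π G.centre) G.centre := rfl

/-! ## §2 The tower along a `Step0 3` chain -/

/-- **The tower of stages along a chain of point blow-ups of the frame** (`Step0 3 (c k) (c (k+1))` for all
`k`): stage `0` is `𝔸⁵_K` with `(z³ + (c 0).F)·𝒪`; stage `i + 1` blows up the marked point of stage `i` and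
re-charts at the edge's point (the edge data `(j, b)` chosen from `Step0`). [folklore] -/
def tower (c : ℕ → State K) (hc : ∀ k, Step0 3 (c k) (c (k + 1))) : ∀ i, GStage K (c i).F
  | 0 => init (c 0).F
  | i + 1 =>
    (tower c hc i).next (c i) rfl (by exact_mod_cast (hc i).1) (hc i).2.choose
      (b := (hc i).2.choose_spec.choose) (hc i).2.choose_spec.choose_spec.2.1 (c (i + 1)).F
      (congrArg CentreBlowup.CState.F (hc i).2.choose_spec.choose_spec.2.2.2.2).symm

/-- The blow-up morphism between consecutive ambients of the tower. [folklore] -/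
def towerπ (c : ℕ → State K) (hc : ∀ k, Step0 3 (c k) (c (k + 1))) (i : ℕ) :
    (tower c hc (i + 1)).Z ⟶ (tower c hc i).Z :=
  blowup.π (tower c hc i).centre

/-- It IS a blowing up of the marked closed point. [folklore] -/
theorem isBlowup_towerπ (c : ℕ → State K) (hc : ∀ k, Step0 3 (c k) (c (k + 1))) (i : ℕ) :
    IsBlowup (towerπ c hc i) (tower c hc i).centre :=
  blowup.isBlowup _

/-- The marked ideals along the tower are the successive transforms. [folklore] -/
theorem tower_succ_M (c : ℕ → State K) (hc : ∀ k, Step0 3 (c k) (c (k + 1))) (i : ℕ) :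
    (tower c hc (i + 1)).M = (tower c hc i).M.transform (towerπ c hc i) (tower c hc i).centre := rfl

/-- The marked points lie over each other. [folklore] -/
theorem towerπ_x (c : ℕ → State K) (hc : ∀ k, Step0 3 (c k) (c (k + 1))) (i : ℕ) :
    towerπ c hc i (tower c hc (i + 1)).x = (tower c hc i).x :=
  next_π_x (tower c hc i) (c i) rfl (by exact_mod_cast (hc i).1) _ _ _ _

end GStage

/-! ## §3 (M-a) The global model of a frame chain -/

/-- **(M-a) THE GLOBAL MODEL.** Over a field `K` of characteristic `3` that is a perfect ring for `3` (e.g.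
algebraically closed), every chain `c` of the frame's point blow-ups (`Step0 3 (c k) (c (k+1))`, all `k`) is
READ by an infinite tower of point blow-ups of ambients: locally noetherian Jacobson schemes `Z i`
(`Z 0 = 𝔸⁵_K`), marked ideals `M i` of multiplicity `3`, CLOSED points `x i`, open-immersion charts
`φ i : 𝔸⁵_K ⟶ Z i` with `φ i 0 = x i` and `(M i).ideal.comap (φ i) = hypSheaf 3 (c i).F`, and blowing ups
`π i : Z (i+1) ⟶ Z i` of `x i` with `M (i+1) = (M i).transform (π i) 𝓘_{x i}` and `π i (x (i+1)) = x i` —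
typ-3's point-centre INVARIANT (`…PointStepPackage`) propagated forever along the chain by
`Equimultiple.exists_chart_step'`. [OURS · sub-row (M-a) of the E2 transfer row]
[cite: BierstoneGrigorievMilmanWlodarczyk2011, §3.2 and Lemma 8.0.3 (2)] -/
theorem globalModel (K : Type) [Field K] [CharP K 3] [PerfectRing K 3] [DecidableEq K] (c : ℕ → State K)
    (hc : ∀ k, Step0 3 (c k) (c (k + 1))) :
    ∃ (Z : ℕ → Scheme.{0}) (_ : ∀ i, IsLocallyNoetherian (Z i)) (_ : ∀ i, JacobsonSpace ↥(Z i))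
      (M : ∀ i, MarkedIdeal (Z i)) (x : ∀ i, ↥(Z i)) (hx : ∀ i, IsClosed ({x i} : Set (Z i)))
      (φ : ∀ i, P 4 K ⟶ Z i) (_ : ∀ i, IsOpenImmersion (φ i)) (π : ∀ i, Z (i + 1) ⟶ Z i),
      ∀ i, (M i).mult = 3 ∧ (φ i) (ξ 4 K) = x i ∧ (M i).ideal.comap (φ i) = hypSheaf 3 (c i).F ∧
        IsBlowup (π i) (vanishingIdeal ⟨{x i}, hx i⟩) ∧
        M (i + 1) = (M i).transform (π i) (vanishingIdeal ⟨{x i}, hx i⟩) ∧ (π i) (x (i + 1)) = x i := by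
  let T := GStage.tower c hc
  exact ⟨fun i => (T i).Z, fun i => (T i).ln, fun i => (T i).js, fun i => (T i).M, fun i => (T i).x,
    fun i => (T i).hx, fun i => (T i).φ, fun i => (T i).oi, fun i => GStage.towerπ c hc i,
    fun i => ⟨(T i).hmult, (T i).hφ, (T i).hM, GStage.isBlowup_towerπ c hc i, GStage.tower_succ_M c hc i,
      GStage.towerπ_x c hc i⟩⟩

/-- **(M-a) for an E2-violating chain over an algebraically closed field** (the binder of `ModelRow`):
algebraically closed fields of characteristic `3` are perfect, and the E2 letters are not needed for the
global model. [OURS · glue] [folklore] -/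
theorem globalModel_of_coneTwoChain (K : Type) [Field K] [CharP K 3] [IsAlgClosed K] [DecidableEq K]
    (c : ℕ → State K)
    (hc : ∀ k, IsIsolated 3 (c k).F ∧ Step0 3 (c k) (c (k + 1)) ∧ ordZero (c k).F = (3 : ℕ∞) ∧
      RidgeBudget.ebar (c k).F = 2) :
    ∃ (Z : ℕ → Scheme.{0}) (_ : ∀ i, IsLocallyNoetherian (Z i)) (_ : ∀ i, JacobsonSpace ↥(Z i))
      (M : ∀ i, MarkedIdeal (Z i)) (x : ∀ i, ↥(Z i)) (hx : ∀ i, IsClosed ({x i} : Set (Z i)))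
      (φ : ∀ i, P 4 K ⟶ Z i) (_ : ∀ i, IsOpenImmersion (φ i)) (π : ∀ i, Z (i + 1) ⟶ Z i),
      ∀ i, (M i).mult = 3 ∧ (φ i) (ξ 4 K) = x i ∧ (M i).ideal.comap (φ i) = hypSheaf 3 (c i).F ∧
        IsBlowup (π i) (vanishingIdeal ⟨{x i}, hx i⟩) ∧
        M (i + 1) = (M i).transform (π i) (vanishingIdeal ⟨{x i}, hx i⟩) ∧ (π i) (x (i + 1)) = x i :=
  globalModel K c fun k => (hc k).2.1

end E2OfCJS

end Summit.ResolutionOfSingularities.ResolutionOfSingularities.Theorems.PIDim4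

end
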